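/-
Copyright (c) 2026 the pub-hodgecm-mathlib formalisation cell (harness21).  Prover seat hodgecm-mathlib-LH7-p08 (g0) (re-dealt to strike line L3 `stub_N6nsDyadic` by director
s1969 (a)), Track A «(D-RAM) FOUR-FRAME» squad, helper lane on h413 = stmt-HodgeConjecture-24833 (count-neutral).  β-BOARD v1 row R8 ∕ (P5) «H `(2ρ,2ρ,2ρ)`», FILE 4c′: the
EXACT boundary letter `|e_A − e_B| = |ϖ|^{2d−2}` of two same-depth tokens at `L − m = 2d − 2`, and the labelled-odd mass of ONE core-hanging orbit under FILE 4a's weak letters.  2026-09-04.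
-/
import Summits.HodgeConjecture.HodgeConjecture.Theorems.F0P3cDyRamLabelledOddCoreHangingCollapsedRead   -- ★ p861966 (this seat, FILE 4a): `labelledOddCount_div_relIndex_coreHanging_eq_of_near₃`
import Summits.HodgeConjecture.HodgeConjecture.Theorems.F0P3cDyRamLabelledOddCoreHangingDeepSum         -- ★ p861620 (this seat, FILE 3b): `v_towerSign_sub_le_of_sub_deep` (§0 letters); brings ★ p861362 FILE 1, ★ κH-B2, ★ tokens, ★ parity
import HarnessLib

/-!
# Crux `H413`, line LH4 «(D-RAM) FOUR-FRAME» — (β) table, β-BOARD row R8 ∕ (P5), FILE 4c′: «THE BOUNDARY LETTER `|e_A − e_B| = |ϖ|^{2d−2}` AND THE LABELLED-ODD MASS OF ONE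
# CORE-HANGING ORBIT UNDER THE WEAK (DEEP-OR-BOUNDARY) LETTERS» — the two bricks of FILE 4c's boundary H row `(m, m, L)`

Cell `hodgecm-mathlib` (D-0151), FLOOR 0, crux item H413 = `stmt-HodgeConjecture-24833`, route `HCCMUnconditional`; squad F0∕P3c∕LH4.  THEOREMS ONLY (no `def`, no instance, no
notation, no `sorry`, default heartbeats); ★-only imports; lane `--supports stmt-HodgeConjecture-24833 --as helper` (count-neutral); pays NO row, states NO law.

THE MATHEMATICS (this seat's H-ROW DERIVATION v1 e4da7f0103cc4a29 §3, key `(m, m, L)` at the BOUNDARY `s_g = L − m = 2d − 2`).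
* §0 `v_towerSign_sub_eq_of_sub_boundary`: for tokens `e` of `α − 1` and `e′` of `β − 1` at the same depth `n` and `|β − α| = |ϖ|^L` with `L + 1 = n + 2d − 1`, the ★ token identity
  `ϖ^{−m*}(e − e′)t₊ = −err_α + err_β − ϖ^{−m*}(β − α)π₀^{−k}` has its last term of valuation `|ϖ|^{−1}`, DOMINATING the two error terms (`≤ 1`): **`|e − e′| = |ϖ|^{2d−2}`** exactly
  (the deep analogue ★ p861620 §0 gave `≤ |ϖ|^{2d−1}` when `L + 1 ≥ n + 2d`).
* §1 `finsum_orbit_labelledOdd_div_relIndex_eq_of_near₃`: the orbit sum of ★ p861620 §1 with FILE 4a's weak letters (`g·g_α + g_β ≠ 0`, `|ϖ|^{2ρ}|g_α| ≤ |ϖ|^{2d−1}|g·g_α + g_β|`,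
  `|ϖ|^ρ|g_β − g_α| ≤ |ϖ|^{2d−1}|g·g_α + g_β|`) in place of the deep letter: `Σᶠ_{orbit of V_H(1,1,g)} m^Λ_i∕[𝒰:N′] = vec(g)_i∕2 · mass`,
  `vec(g) = (ω(g)·ε·ι, ε·ι, ω(−(1+g))·ε)`, `ε = ω(g·g_α + g_β)`, `ι = [2d−1 ≤ ρ]` (★ p861620 §1's letter shape), `mass` = ★ (C) `finsum_stabiliserWeight_orbit_eq`.
HONEST LABEL.  Count-neutral (`--supports`); the boundary H rows, the shallow keys, the equilateral key, `hRest`, (T3), (β-BAL), (β), T₊ stay OPEN; `HC_CM` is proved only modulo the 7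
printed citations (2 remaining named inputs: hLiu418 = `stmt-HodgeConjecture-24832`, h413 = `stmt-HodgeConjecture-24833`) until rung 0 closes.

## References
* [Kottwitz1986BaseChangeUnits] R. E. Kottwitz, *Base change for unit elements of Hecke algebras*, Compositio Math. 60 (1986), §1 pp. 240–241 (signed lattice counts modulo the torus).
* [LanglandsShelstad1987] R. P. Langlands, D. Shelstad, *On the definition of transfer factors*, Math. Ann. 278 (1987), §3.
* [Rogawski1990] J. D. Rogawski, *Automorphic Representations of Unitary Groups in Three Variables*, Ann. of Math. Stud. 123 (1990), §4.9 Prop. 4.9.1 (a)(b) p. 55, §4.10 p. 58.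
* [Serre1979] J.-P. Serre, *Local Fields*, GTM 67 (1979), Ch. V §3 Cor. 3, Ch. XV §2.
-/

set_option autoImplicit false

noncomputable section

namespace Summit.HodgeConjecture.HodgeConjecture.Cruxes.H413.F0P3cDyRamLabelledOddCoreHangingBoundaryOrbit

open Matrix WithZero
open Literature.NumberTheory.Automorphic Literature.NumberTheory.Automorphic.HermitianLattice Literature.NumberTheory.Automorphic.UnitaryGroup
open Literature.NumberTheory.Automorphic.UnitaryLatticeTree Literature.NumberTheory.Automorphic.UnitaryThreeFourFrame
open Literature.NumberTheory.LocalFields Literature.NumberTheory.LocalFields.WildQuadraticDatum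
open Summit.HodgeConjecture.HodgeConjecture.Cruxes.H413.F0P3cDyRamFourFramePieces
open Summit.HodgeConjecture.HodgeConjecture.Cruxes.H413.F0P3cDyRamFourFrameCensusDefs
open Summit.HodgeConjecture.HodgeConjecture.Cruxes.H413.F0P3cDyRamStageOneBDefs
open Summit.HodgeConjecture.HodgeConjecture.Cruxes.H413.F0P3cDyRamDiagonalTorusDefs
open Summit.HodgeConjecture.HodgeConjecture.Cruxes.H413.F0P3cDyRamDiagonalStrataDefs
open Summit.HodgeConjecture.HodgeConjecture.Cruxes.H413.F0P3cDyRamLabelledOddCountDefs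
open Summit.HodgeConjecture.HodgeConjecture.Cruxes.H413.F0P3cDyRamLabelledOddCoreHangingCollapsedRead (labelledOddCount_div_relIndex_coreHanging_eq_of_near₃)
open Summit.HodgeConjecture.HodgeConjecture.Cruxes.H413.F0P3cDyRamLabelledOddCoreHangingDeepSum (v_towerSign_sub_le_of_sub_deep)
open Summit.HodgeConjecture.HodgeConjecture.Cruxes.H413.F0P3cDyRamLabelledOddCoreHangingShell (shell_iff_of_mem_stratum_H finsum_stratum_H_shell_eq_of_eq)
open Summit.HodgeConjecture.HodgeConjecture.Cruxes.H413.F0P3cDyRamDiagonalCoreHangingSocket (stratum_H_eq)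
open Summit.HodgeConjecture.HodgeConjecture.Cruxes.H413.F0P3cDyRamDiagonalCoreHangingCount (coreHangingStratum_eq_iUnion_orbits pairwise_disjoint_orbits finsum_stabiliserWeight_orbit_eq)
open Summit.HodgeConjecture.HodgeConjecture.Cruxes.H413.F0P3cDyRamDiagonalCoreHangingOrbits (exists_coreHanging_of_mem_orbit)
open Summit.HodgeConjecture.HodgeConjecture.Cruxes.H413.F0P3cDyRamDiagonalCoreHangingClasses (ncard_admissible_representatives_eq)
open Summit.HodgeConjecture.HodgeConjecture.Cruxes.H413.F0P3cDyRamDiagonalGluedTorusOrbits (exists_gl_coe_eq_glued)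
open Summit.HodgeConjecture.HodgeConjecture.Cruxes.H413.F0P3cDyRamDiagonalGluedClassRepresentatives (exists_fixed_class_representatives)
open Summit.HodgeConjecture.HodgeConjecture.Cruxes.H413.F0P3cDyRamDiagonalGluedStabiliserIndex (ne_zero_and_v_lt_one_of_v_eq_exp)
open Summit.HodgeConjecture.HodgeConjecture.Cruxes.H413.F0P3cDyRamDiagonalKappaCoreHangingSocket (finite_orbit)
open Summit.HodgeConjecture.HodgeConjecture.Cruxes.H413.F0P3cDyRamDiagonalCoreHangingPolarisationExplicit (normSign_mul_norm')
open Summit.HodgeConjecture.HodgeConjecture.Cruxes.H413.F0P3cDyRamStableCountTypeZero (v_diag_eq_one)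
open Summit.HodgeConjecture.HodgeConjecture.Cruxes.H413.F0P3cDyRamDiagonalStratumTools (finsum_mem_eq_ncard_mul)
open Summit.HodgeConjecture.HodgeConjecture.Cruxes.H413.F0P3cDyRamDiagonalKappaCoreHangingClass (two_le_d_of_v_two_lt_one)
open scoped Valued WithZero Matrix MatrixGroups

variable {K : Type} [Field K] [Valued K ℤᵐ⁰]

/-! ## §0  At the boundary the two same-depth tokens are EXACTLY `𝔭^{2d−2}` apart -/

/-- **`|e − e′| = |ϖ|^{2d−2}`** for tower-sign tokens `e` of `α − 1` and `e′` of `β − 1` at the same depth parameter `n ≡ d (mod 2)` when `|β − α| = |ϖ|^L` with `L + 1 = n + 2d − 1`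
(the BOUNDARY `L − n = 2d − 2`): in the ★ token identity `ϖ^{−m*}(e − e′)t₊ = −(err_α) + (err_β) − ϖ^{−m*}(β − α)π₀^{−k}` the last term has valuation `|ϖ|^{−1}` and dominates.
[cite: Serre1979, Ch. V §3] [cite: Rogawski1990, §4.9 p. 55] -/
theorem v_towerSign_sub_eq_of_sub_boundary {σ : K →+* K} {ϖ : K} {d t : ℕ} (hD : IsRamifiedQuadraticDatum σ ϖ d t)
    {α β : K} {n L : ℕ} (hvβα : Valued.v (β - α) = Valued.v ϖ ^ L) (hL : L + 1 = n + 2 * d - 1) (hn : d % 2 ≤ n) (hpar : n % 2 = d % 2)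
    {e e' : K}
    (he : Valued.v ((ϖ ^ mstarOfRecord d)⁻¹ * ((α - 1) * ((ϖ * σ ϖ) ^ ((n - d % 2) / 2))⁻¹ - e * ((ϖ - σ ϖ) * ((ϖ * σ ϖ) ^ ((d - d % 2) / 2))⁻¹))) ≤ 1)
    (he' : Valued.v ((ϖ ^ mstarOfRecord d)⁻¹ * ((β - 1) * ((ϖ * σ ϖ) ^ ((n - d % 2) / 2))⁻¹ - e' * ((ϖ - σ ϖ) * ((ϖ * σ ϖ) ^ ((d - d % 2) / 2))⁻¹))) ≤ 1) :
    Valued.v (e - e') = Valued.v ϖ ^ (2 * d - 2) := by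
  obtain ⟨hσ, hvσ, hϖ, -, hd, h1d, -⟩ := id hD
  have hϖ0 : ϖ ≠ 0 := fun h => by rw [h, map_zero] at hϖ; exact (coe_ne_zero hϖ.symm).elim
  have hvϖ0 : Valued.v ϖ ≠ 0 := (Valuation.ne_zero_iff _).2 hϖ0
  obtain ⟨k, hnk⟩ : ∃ k : ℕ, n = 2 * k + d % 2 := ⟨n / 2, by omega⟩
  have hk : (n - d % 2) / 2 = k := by omega
  rw [hk] at he he'
  set P : K := ((ϖ * σ ϖ) ^ k)⁻¹ with hPdef
  set tp : K := (ϖ - σ ϖ) * ((ϖ * σ ϖ) ^ ((d - d % 2) / 2))⁻¹ with htpdef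
  set M : K := (ϖ ^ mstarOfRecord d)⁻¹ with hMdef
  have hvtp : Valued.v tp = Valued.v ϖ ^ (d % 2) := by rw [htpdef, v_refSkewScalar hvσ hϖ hd, v_varpi_pow hϖ]
  have hvP : Valued.v P = (Valued.v ϖ ^ (2 * k))⁻¹ := by rw [hPdef, map_inv₀, map_pow, map_mul, hvσ, ← pow_two, ← pow_mul]
  have hvM : Valued.v M = (Valued.v ϖ ^ mstarOfRecord d)⁻¹ := by rw [hMdef, map_inv₀, map_pow]
  have hid : M * ((e - e') * tp) = (-(M * ((α - 1) * P - e * tp)) + M * ((β - 1) * P - e' * tp)) + -(M * ((β - α) * P)) := by ring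
  -- the dominating term: `|M(β−α)P| = |ϖ|^{−1}`
  have hm : mstarOfRecord d = 2 * d - 1 + d % 2 := by unfold mstarOfRecord; omega
  have h3 : Valued.v (-(M * ((β - α) * P))) = (Valued.v ϖ)⁻¹ := by
    rw [Valuation.map_neg, map_mul, map_mul, hvM, hvP, hvβα, hm, v_varpi_pow hϖ, v_varpi_pow hϖ, v_varpi_pow hϖ, hϖ, ← WithZero.exp_neg, ← WithZero.exp_neg, ← WithZero.exp_neg, ← WithZero.exp_add, ← WithZero.exp_add]
    congr 1; omega
  have h12 : Valued.v (-(M * ((α - 1) * P - e * tp)) + M * ((β - 1) * P - e' * tp)) ≤ 1 := by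
    refine (Valuation.map_add _ _ _).trans (max_le ?_ he')
    rw [Valuation.map_neg]; exact he
  have hlt : Valued.v (-(M * ((α - 1) * P - e * tp)) + M * ((β - 1) * P - e' * tp)) < Valued.v (-(M * ((β - α) * P))) := by
    rw [h3]; refine h12.trans_lt ?_
    rw [hϖ, ← WithZero.exp_neg, ← exp_zero, exp_lt_exp]; norm_num
  have htot : Valued.v (M * ((e - e') * tp)) = (Valued.v ϖ)⁻¹ := by
    rw [hid, add_comm, Valuation.map_add_eq_of_lt_left _ hlt, h3]
  rw [map_mul, map_mul, hvM, hvtp] at htot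
  -- solve for `|e − e′|`
  have hM0 : (Valued.v ϖ ^ mstarOfRecord d) ≠ 0 := pow_ne_zero _ hvϖ0
  have hT0 : (Valued.v ϖ ^ (d % 2)) ≠ 0 := pow_ne_zero _ hvϖ0
  rw [inv_mul_eq_iff_eq_mul₀ hM0, ← eq_mul_inv_iff_mul_eq₀ hT0] at htot
  rw [htot, hm, v_varpi_pow hϖ, v_varpi_pow hϖ, v_varpi_pow hϖ, hϖ, ← WithZero.exp_neg, ← WithZero.exp_neg, ← WithZero.exp_add, ← WithZero.exp_add]
  congr 1; omega

/-! ## §1  One orbit: the per-lattice value is constant by value along `𝒯·latt V_H(1,1,g)` (FILE 4a on every member) -/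

/-- **THE LABELLED-ODD MASS OF ONE CORE-HANGING ORBIT UNDER FILE 4a's WEAK LETTERS.**  For a fixed unit `g` with `|1 + g| = 1`, every member of the unit-torus orbit of `V_H(1,1,g)` is a core-hanging
lattice with the EXACT invariant `g` (★ (A) `exists_coreHanging_of_mem_orbit`), so FILE 4a (`…_eq_of_near₃`) gives its value `w(M)∕2·vec(g)_i`,
`vec(g) = (ω(g)·ε·ι, ε·ι, ω(−(1+g))·ε)`, `ε = ω(g·g_α + g_β)`, `ι = [2d−1 ≤ ρ]`, on the whole orbit, and `Σᶠ_{orbit} = vec(g)_i∕2 · Σᶠ_{orbit} w` (★ (C) `finsum_stabiliserWeight_orbit_eq`).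
[cite: Kottwitz1986BaseChangeUnits, §1 pp. 240–241] [cite: LanglandsShelstad1987, §3] -/
theorem finsum_orbit_labelledOdd_div_relIndex_eq_of_near₃ [CompleteSpace K] [Finite 𝓀[K]] {σ : K →+* K} {ϖ : K} {d t : ℕ}
    (hD : IsRamifiedQuadraticDatum σ ϖ d t) (h2 : Valued.v (2 : K) < 1) {ρ : ℕ} (hρ : 1 ≤ ρ)
    {g : K} (hσg : σ g = g) (hvg : Valued.v g = 1) (h1g : Valued.v (1 + g) = 1)
    {α β : K} {N₀ n₁ n₂ n₃ : ℕ} (hE : IsElementDatum σ ϖ N₀ α β n₁ n₂ n₃) {mc : ℕ} (hℓN : d % 2 + 1 ≤ N₀) (hmN : d % 2 + 2 * d - 1 ≤ N₀)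
    (hℓmc : 2 * (d % 2) + 1 ≤ mc) (hmmc : d % 2 + 2 * d - 1 + d % 2 ≤ mc)
    {T : GL (Fin 3) K} (hT : (T : Matrix (Fin 3) (Fin 3) K) = Matrix.diagonal ![α, β, 1])
    (horb : ∀ M ∈ {M : Submodule 𝒪[K] (Fin 3 → K) | ∃ u ∈ unitTorus K 3,
        M = mapGL (diagGLUnits u) (latt (!![1, 0, 0; 1, ϖ ^ ρ, 0; 1 * 1 + g, ϖ ^ ρ * 1, ϖ ^ (2 * ρ)] : Matrix (Fin 3) (Fin 3) K))},
      M ∈ normalisedStableLattices T ∧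
        LatticeInLevel ϖ (d % 2) (Matrix.diagonal ![α - 1, β - 1, 0]) M ∧ ¬ LatticeInLevel ϖ (d % 2 + 1) (Matrix.diagonal ![α - 1, β - 1, 0]) M ∧
          LatticeInLevel ϖ mc (Matrix.diagonal ![(α - 1) * (α - 1), (β - 1) * (β - 1), 0]) M)
    {gα gβ : K} (hσgα : σ gα = gα) (hσgβ : σ gβ = gβ) (hG0 : g * gα + gβ ≠ 0)
    (hdom : Valued.v ϖ ^ (2 * ρ) * Valued.v gα ≤ Valued.v ϖ ^ (2 * d - 1) * Valued.v (g * gα + gβ))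
    (hnear : Valued.v ϖ ^ ρ * Valued.v (gβ - gα) ≤ Valued.v ϖ ^ (2 * d - 1) * Valued.v (g * gα + gβ))
    (hgα : Valued.v ((ϖ ^ (d % 2 + 2 * d - 1))⁻¹ * (((ϖ * σ ϖ) ^ ρ)⁻¹ * ((α - 1) - gα * ((ϖ - σ ϖ) * ((ϖ * σ ϖ) ^ ((d - d % 2) / 2))⁻¹)))) ≤ 1)
    (hgβ : Valued.v ((ϖ ^ (d % 2 + 2 * d - 1))⁻¹ * (((ϖ * σ ϖ) ^ ρ)⁻¹ * ((β - 1) - gβ * ((ϖ - σ ϖ) * ((ϖ * σ ϖ) ^ ((d - d % 2) / 2))⁻¹)))) ≤ 1)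
    (i : Fin 3) :
    ∑ᶠ M ∈ {M : Submodule 𝒪[K] (Fin 3 → K) | ∃ u ∈ unitTorus K 3, M = mapGL (diagGLUnits u) (latt (!![1, 0, 0; 1, ϖ ^ ρ, 0; 1 * 1 + g, ϖ ^ ρ * 1, ϖ ^ (2 * ρ)] : Matrix (Fin 3) (Fin 3) K))},
        (labelledOddCount σ ϖ 0 i (valueClassLabel σ ϖ (α - 1) (β - 1) (d % 2 + 2 * d - 1) d) M : ℚ) /
          ((((unitStabilizer M).map (unitNormMap σ 3)).relIndex (fixedUnitTorus σ 3) : ℕ) : ℚ) =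
      ((((![normSign σ g * normSign σ (g * gα + gβ) * (if 2 * d - 1 ≤ ρ then 1 else 0),
           normSign σ (g * gα + gβ) * (if 2 * d - 1 ≤ ρ then 1 else 0),
           normSign σ (-(1 + g)) * normSign σ (g * gα + gβ)] : Fin 3 → ℤ) i : ℤ)) : ℚ) / 2 *
        (((((Nat.card 𝓀[K] - 1) * Nat.card 𝓀[K] ^ (ρ - 1)) * ((Nat.card 𝓀[K] - 1) * Nat.card 𝓀[K] ^ (2 * ρ - 1)) : ℕ) : ℚ) *
          ((((Nat.card 𝓀[K] - 1) * Nat.card 𝓀[K] ^ ((ρ + 1) / 2 - 1)) * ((Nat.card 𝓀[K] - 1) * Nat.card 𝓀[K] ^ (ρ - 1)) : ℕ) : ℚ)⁻¹) := by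
  obtain ⟨hσ, hvσ, hϖ, hfix, hd, -, -⟩ := id hD
  obtain ⟨hϖ0, -⟩ := ne_zero_and_v_lt_one_of_v_eq_exp hϖ
  -- the value is constant on the orbit, by value (FILE 4a on every member)
  have hconst : ∀ M ∈ {M : Submodule 𝒪[K] (Fin 3 → K) | ∃ u ∈ unitTorus K 3,
        M = mapGL (diagGLUnits u) (latt (!![1, 0, 0; 1, ϖ ^ ρ, 0; 1 * 1 + g, ϖ ^ ρ * 1, ϖ ^ (2 * ρ)] : Matrix (Fin 3) (Fin 3) K))},
      (labelledOddCount σ ϖ 0 i (valueClassLabel σ ϖ (α - 1) (β - 1) (d % 2 + 2 * d - 1) d) M : ℚ) /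
          ((((unitStabilizer M).map (unitNormMap σ 3)).relIndex (fixedUnitTorus σ 3) : ℕ) : ℚ) =
        ((((![normSign σ g * normSign σ (g * gα + gβ) * (if 2 * d - 1 ≤ ρ then 1 else 0),
           normSign σ (g * gα + gβ) * (if 2 * d - 1 ≤ ρ then 1 else 0),
           normSign σ (-(1 + g)) * normSign σ (g * gα + gβ)] : Fin 3 → ℤ) i : ℤ)) : ℚ) / 2 * stabiliserWeight σ M := by
    intro M hM
    obtain ⟨hM0, hlev, hnlev, hsq⟩ := horb M hM
    obtain ⟨u, hu, rfl⟩ := hM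
    obtain ⟨V₀, hV₀⟩ := exists_gl_coe_eq_glued (1 : K) 1 g (pow_ne_zero ρ hϖ0) (pow_ne_zero (2 * ρ) hϖ0)
    obtain ⟨x', ζ', y₁, hx', hζ', -, -, hκ, hMe⟩ := exists_coreHanging_of_mem_orbit u hu hvg h1g (ϖ ^ ρ) (ϖ ^ (2 * ρ)) V₀ hV₀
    have hx0 : x' ≠ 0 := fun h0 => by rw [h0, map_zero] at hx'; exact zero_ne_one hx'
    have hζ0 : ζ' ≠ 0 := fun h0 => by rw [h0, map_zero] at hζ'; exact zero_ne_one hζ'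
    have hy₁ : y₁ = g * (x' * ζ') := by rw [← hκ]; field_simp
    obtain ⟨V, hV⟩ := exists_gl_coe_eq_glued x' ζ' (g * (x' * ζ')) (pow_ne_zero ρ hϖ0) (pow_ne_zero (2 * ρ) hϖ0)
    rw [← hV₀] at hM0 hlev hnlev hsq ⊢
    rw [hMe, hy₁, ← hV] at hM0 hlev hnlev hsq ⊢
    rw [labelledOddCount_div_relIndex_coreHanging_eq_of_near₃ hD h2 hρ hx' hζ' hσg hvg h1g V hV hE hℓN hmN hℓmc hmmc hT hM0 hlev hnlev hsq
      hσgα hσgβ hG0 hdom hnear hgα hgβ i]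
    by_cases hal : 2 * d - 1 ≤ ρ
    · fin_cases i <;> simp [hal] <;> ring
    · fin_cases i <;> simp [hal]
      ring
  rw [finsum_mem_congr rfl hconst, ← mul_finsum_mem, finsum_stabiliserWeight_orbit_eq hσ hvσ hfix hϖ hd hρ hσg hvg]

end Summit.HodgeConjecture.HodgeConjecture.Cruxes.H413.F0P3cDyRamLabelledOddCoreHangingBoundaryOrbit

end
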